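/-
Copyright: the b2b-balaban T⁴-continuum CRUX team, row NE7b OWNER lineage `t4-ne7b-p1` (gen 141). Project licence.
-/
import Summits.QuantumFields.BalabanUV.T4Continuum.Spine.NE7b.SupWhitenedFourthCumulantTree
import Summits.QuantumFields.BalabanUV.T4Continuum.Spine.NE7b.SupFourPointTreeRowSum

/-!
# THE ROW LETTER OF THE WHITENED FOURTH CUMULANT (SCOPING (d13)(2), eleventh file): (497)'s tree bound summed over three sites by (488).  For
# the whitened gradient components of the fluctuation step with a general `Γ = AAᵀ`, under (497)'s hypotheses and the site letters of the
# weight `q_{uv} = r_{uv}⁻²` (rows AND columns `≤ S`),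
#   `Σ_y Σ_z Σ_t |u₄(F_x,F_y,F_z,F_t)| ≤ (4K + 3K² + 4M₄ + 4M₆ + 2M₂(M₂+M₄))·16·S³`
# — UNIFORM IN THE BACKGROUND, THE SITE `x` AND THE VOLUME: the cumulant piece of the FOURTH-order kernel letter, the order-4 analogue of (468)
# (row NE7b, node U5c; (497), (488) BY NAME; [folklore])

Cell `pub-balaban`, sub-cell `t4`, spine estimate NE7b (`T4WeightBudget.RelWeightBound`; the cell's OWN estimate — NOT PRINTED in
[Bałaban 1983–89], NOT PROVED).  Crux-route work under `Spine/NE7b/` by the row OWNER (`t4-ne7b-p1` gen 141, file (498)) under FREEZE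
(0)'s crux-prover clause; NOTHING of Bałaban's is named as a Lean object, valued or asserted; no `T4Continuum/Support` leaf typed; no
`def`, no notation; zero `sorry`.  Imports (BY NAME): the OWNER's (497) `…SupWhitenedFourthCumulantTree` (`whitened_fourth_cumulant_tree`),
(488) `…SupFourPointTreeRowSum` (`tree_sum_row_le`).

WHAT IS PROVED ([folklore]): THE END **`whitened_fourth_cumulant_row_letter`**; toy.

HONEST (what this is NOT).  The cumulant piece's row letter at order 4 with `M₆` a LETTER; the other pieces of `∂⁴W` (`⟨U⁗⟩`, `Cov(U‴,U′)`,
`Cov(U″,U″)`, `κ₃(U″,U′,U′)`), its cumulant FORM and the assembly are NOT typed; scalar skeleton ((A3), NC-NE7b-α UNRULED); nothing of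
Bałaban's asserted.  BY-NAME EFFECT ON THE WALL: NONE.  NE7b NOT PRINTED ∕ NOT PROVED; spine PROVED 0∕9; rung (B)+1 — the programme's
measures remain FINITE-torus statements; NOT the mass gap, NOT Clay.  HONEST DEPENDENCY: continuum YM on T⁴ ⇐ BetaPertH ∧ nine spine
estimates (0∕9 proved); BetaPertH ⇐ (D1) ∧ (D4) ∧ CAP+tail; G-an2-4 gates asym, D1 and NE2∕3∕4.
-/

set_option autoImplicit false
set_option maxSynthPendingDepth 2

noncomputable section

namespace Summit.QuantumFields.BalabanUV.T4Continuum.NE7b.SupWhitenedFourthCumulantRowLetter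

open MeasureTheory ProbabilityTheory Real Set Function Finset Matrix
open scoped BigOperators
open Literature.Probability.Distributions (matrixCLM)
open SupWhitenedFourthCumulantTree (whitened_fourth_cumulant_tree)
open SupFourPointTreeRowSum (tree_sum_row_le)
open SupWhitenedFirstOrderLetters (whitened_obs_nonneg)

variable {ι κ : Type} [Fintype ι] [DecidableEq ι] [Fintype κ] [DecidableEq κ]

variable {U : EuclideanSpace ℝ ι → ℝ} {U' : EuclideanSpace ℝ ι → EuclideanSpace ℝ ι →L[ℝ] ℝ}
  {U'' : EuclideanSpace ℝ ι → EuclideanSpace ℝ ι →L[ℝ] EuclideanSpace ℝ ι →L[ℝ] ℝ} {Hk : ι → ι → ℝ} {A : Matrix ι κ ℝ} {D : κ → κ → ℝ}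
  {γop κ₀ κ₁ κ₂ a τ δ θp lam lamA αr αc hr γ dθ dθ' αθ βθ M₆ S : ℝ} {θ : κ → κ → ℝ} {σ : ι → κ → ℝ} {r : ι → ι → ℝ}

/-- **THE END — THE ROW LETTER OF THE WHITENED FOURTH CUMULANT**: `Σ_yΣ_zΣ_t|u₄| ≤ C·(16·S³)`. [folklore] -/
theorem whitened_fourth_cumulant_row_letter [Nonempty κ] (hΓop : (γop • (1 : Matrix ι ι ℝ) - A * Aᵀ).PosSemidef) (Y : Finset ι)
    (hUd : ∀ φ : EuclideanSpace ℝ ι, HasFDerivAt U (U' φ) φ) (hU'd : ∀ φ : EuclideanSpace ℝ ι, HasFDerivAt U' (U'' φ) φ)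
    (hU''c : Continuous U'') (hκ₀ : 0 ≤ κ₀) (hκ₁ : 0 ≤ κ₁) (ha : 0 ≤ a) (hτ : 0 < τ) (hδ : 0 < δ) (hθ0 : 0 < θp) (hθ1 : θp < 1)
    (hκθ : (2 * κ₀ * (1 + τ) + 4 * δ) * γop ≤ θp) (hκθw : 2 * κ₀ * (1 + τ) * γop + 4 * δ ≤ θp)
    (hstab : ∀ φ : EuclideanSpace ℝ ι, -(κ₀ * ∑ x ∈ Y, φ x ^ 2) ≤ U φ)
    (hU'b : ∀ φ : EuclideanSpace ℝ ι, ‖U' φ‖ ≤ κ₁ * (a + ∑ x ∈ Y, φ x ^ 2)) (hU''b : ∀ φ : EuclideanSpace ℝ ι, ‖U'' φ‖ ≤ κ₂) (hlam : 0 ≤ lam)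
    (hUsec : ∀ s : ℝ, 0 ≤ s → s ≤ 1 → ∀ a b : EuclideanSpace ℝ ι,
      U ((1 - s) • a + s • b) - lam / 2 * (s * (1 - s)) * ∑ i, (a i - b i) ^ 2 ≤ (1 - s) * U a + s * U b)
    (hρg : lam * γop < 1)
    (hHk : ∀ (φ : EuclideanSpace ℝ ι) (x z : ι), |U'' φ (EuclideanSpace.single z (1 : ℝ)) (EuclideanSpace.single x (1 : ℝ))| ≤ Hk x z)
    (hHk0 : ∀ v u, 0 ≤ Hk v u) (ψ : EuclideanSpace ℝ ι)
    (hαr : ∀ u, ∑ w, |A u w| ≤ αr) (hαc : ∀ w, ∑ u, |A u w| ≤ αc) (hhr : ∀ v, ∑ u, Hk v u ≤ hr)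
    (hlamA : ∀ x : κ, ∑ u, ∑ v, |A u x| * |A v x| * Hk v u ≤ lamA) (hlamA1 : lamA < 1) (hγ : αc * hr * αr / (1 - lamA) ≤ γ) (hγ1 : γ < 1)
    -- the admissible `D` with weighted letters, the weights, the weighted profiles
    (hD : ∀ x y, 0 ≤ D x y)
    (hDC : ∀ x y, (if x = y then (1 : ℝ) else 0) + ∑ z, D x z * ((if y = z then 0 else ∑ u, ∑ v, |A u y| * |A v z| * Hk v u) / (1 - lamA)) ≤ D x y)
    (hθnn : ∀ z w, 0 ≤ θ z w) (hDr : ∀ z, ∑ w, D z w * θ z w ≤ dθ) (hdθ : 0 ≤ dθ) (hDc : ∀ w, ∑ z, D z w * θ z w ≤ dθ') (hdθ' : 0 ≤ dθ')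
    (hσ0 : ∀ x w, 0 ≤ σ x w) (hσθ : ∀ x z w, σ x w ≤ σ x z * θ z w) (hr1 : ∀ x y, 1 ≤ r x y) (hrσ : ∀ x y w, r x y ^ 24 ≤ σ x w * σ y w)
    (haσ : ∀ v : ι, ∑ w, (∑ u, |A u w| * Hk v u) * σ v w ≤ αθ) (hβ : 0 ≤ βθ) (haσ' : ∀ (v : ι) (w : κ), (∑ u, |A u w| * Hk v u) * σ v w ≤ βθ)
    -- the sixth-moment letter
    (hI6 : ∀ (v : ι) (c : ℝ), Integrable (fun z : κ → ℝ => (U' (matrixCLM A (WithLp.toLp 2 z) + ψ) (EuclideanSpace.single v (1 : ℝ)) - c) ^ 6)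
        ((volume : Measure (κ → ℝ)).tilted fun z => -(1 / 2 * (z ⬝ᵥ z) + U (matrixCLM A (WithLp.toLp 2 z) + ψ))))
    (hM6 : ∀ v : ι, ∫ w, (U' (matrixCLM A (WithLp.toLp 2 w) + ψ) (EuclideanSpace.single v (1 : ℝ)) - (∫ w', U' (matrixCLM A (WithLp.toLp 2 w') + ψ)
        (EuclideanSpace.single v (1 : ℝ)) ∂((volume : Measure (κ → ℝ)).tilted fun z => -(1 / 2 * (z ⬝ᵥ z) + U (matrixCLM A (WithLp.toLp 2 z) + ψ)))))
        ^ 6 ∂((volume : Measure (κ → ℝ)).tilted fun z => -(1 / 2 * (z ⬝ᵥ z) + U (matrixCLM A (WithLp.toLp 2 z) + ψ))) ≤ M₆)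
    (hSr : ∀ u, ∑ v, (r u v ^ 2)⁻¹ ≤ S) (hSc : ∀ v, ∑ u, (r u v ^ 2)⁻¹ ≤ S) (x : ι) :
    ∑ y, ∑ z, ∑ t, |(∫ w, (U' (matrixCLM A (WithLp.toLp 2 w) + ψ) (EuclideanSpace.single x (1 : ℝ)) - (∫ w', U' (matrixCLM A (WithLp.toLp 2 w') + ψ)
        (EuclideanSpace.single x (1 : ℝ)) ∂((volume : Measure (κ → ℝ)).tilted fun z => -(1 / 2 * (z ⬝ᵥ z) + U (matrixCLM A (WithLp.toLp 2 z) + ψ)))))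
        * (U' (matrixCLM A (WithLp.toLp 2 w) + ψ) (EuclideanSpace.single y (1 : ℝ)) - (∫ w', U' (matrixCLM A (WithLp.toLp 2 w') + ψ)
        (EuclideanSpace.single y (1 : ℝ)) ∂((volume : Measure (κ → ℝ)).tilted fun z => -(1 / 2 * (z ⬝ᵥ z) + U (matrixCLM A (WithLp.toLp 2 z) + ψ)))))
        * (U' (matrixCLM A (WithLp.toLp 2 w) + ψ) (EuclideanSpace.single z (1 : ℝ)) - (∫ w', U' (matrixCLM A (WithLp.toLp 2 w') + ψ)
        (EuclideanSpace.single z (1 : ℝ)) ∂((volume : Measure (κ → ℝ)).tilted fun z => -(1 / 2 * (z ⬝ᵥ z) + U (matrixCLM A (WithLp.toLp 2 z) + ψ)))))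
        * (U' (matrixCLM A (WithLp.toLp 2 w) + ψ) (EuclideanSpace.single t (1 : ℝ)) - (∫ w', U' (matrixCLM A (WithLp.toLp 2 w') + ψ)
        (EuclideanSpace.single t (1 : ℝ)) ∂((volume : Measure (κ → ℝ)).tilted fun z => -(1 / 2 * (z ⬝ᵥ z) + U (matrixCLM A (WithLp.toLp 2 z) + ψ)))))
        ∂((volume : Measure (κ → ℝ)).tilted fun z => -(1 / 2 * (z ⬝ᵥ z) + U (matrixCLM A (WithLp.toLp 2 z) + ψ)))) - (∫ w, (U' (matrixCLM A
        (WithLp.toLp 2 w) + ψ) (EuclideanSpace.single x (1 : ℝ)) - (∫ w', U' (matrixCLM A (WithLp.toLp 2 w') + ψ) (EuclideanSpace.single x (1 : ℝ))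
        ∂((volume : Measure (κ → ℝ)).tilted fun z => -(1 / 2 * (z ⬝ᵥ z) + U (matrixCLM A (WithLp.toLp 2 z) + ψ))))) * (U' (matrixCLM A (WithLp.toLp 2
        w) + ψ) (EuclideanSpace.single y (1 : ℝ)) - (∫ w', U' (matrixCLM A (WithLp.toLp 2 w') + ψ) (EuclideanSpace.single y (1 : ℝ)) ∂((volume :
        Measure (κ → ℝ)).tilted fun z => -(1 / 2 * (z ⬝ᵥ z) + U (matrixCLM A (WithLp.toLp 2 z) + ψ))))) ∂((volume : Measure (κ → ℝ)).tilted fun z =>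
        -(1 / 2 * (z ⬝ᵥ z) + U (matrixCLM A (WithLp.toLp 2 z) + ψ)))) * (∫ w, (U' (matrixCLM A (WithLp.toLp 2 w) + ψ) (EuclideanSpace.single z (1 :
        ℝ)) - (∫ w', U' (matrixCLM A (WithLp.toLp 2 w') + ψ) (EuclideanSpace.single z (1 : ℝ)) ∂((volume : Measure (κ → ℝ)).tilted fun z => -(1 / 2 *
        (z ⬝ᵥ z) + U (matrixCLM A (WithLp.toLp 2 z) + ψ))))) * (U' (matrixCLM A (WithLp.toLp 2 w) + ψ) (EuclideanSpace.single t (1 : ℝ)) - (∫ w', U'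
        (matrixCLM A (WithLp.toLp 2 w') + ψ) (EuclideanSpace.single t (1 : ℝ)) ∂((volume : Measure (κ → ℝ)).tilted fun z => -(1 / 2 * (z ⬝ᵥ z) + U
        (matrixCLM A (WithLp.toLp 2 z) + ψ))))) ∂((volume : Measure (κ → ℝ)).tilted fun z => -(1 / 2 * (z ⬝ᵥ z) + U (matrixCLM A (WithLp.toLp 2 z) +
        ψ)))) - (∫ w, (U' (matrixCLM A (WithLp.toLp 2 w) + ψ) (EuclideanSpace.single x (1 : ℝ)) - (∫ w', U' (matrixCLM A (WithLp.toLp 2 w') + ψ)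
        (EuclideanSpace.single x (1 : ℝ)) ∂((volume : Measure (κ → ℝ)).tilted fun z => -(1 / 2 * (z ⬝ᵥ z) + U (matrixCLM A (WithLp.toLp 2 z) + ψ)))))
        * (U' (matrixCLM A (WithLp.toLp 2 w) + ψ) (EuclideanSpace.single z (1 : ℝ)) - (∫ w', U' (matrixCLM A (WithLp.toLp 2 w') + ψ)
        (EuclideanSpace.single z (1 : ℝ)) ∂((volume : Measure (κ → ℝ)).tilted fun z => -(1 / 2 * (z ⬝ᵥ z) + U (matrixCLM A (WithLp.toLp 2 z) + ψ)))))
        ∂((volume : Measure (κ → ℝ)).tilted fun z => -(1 / 2 * (z ⬝ᵥ z) + U (matrixCLM A (WithLp.toLp 2 z) + ψ)))) * (∫ w, (U' (matrixCLM A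
        (WithLp.toLp 2 w) + ψ) (EuclideanSpace.single y (1 : ℝ)) - (∫ w', U' (matrixCLM A (WithLp.toLp 2 w') + ψ) (EuclideanSpace.single y (1 : ℝ))
        ∂((volume : Measure (κ → ℝ)).tilted fun z => -(1 / 2 * (z ⬝ᵥ z) + U (matrixCLM A (WithLp.toLp 2 z) + ψ))))) * (U' (matrixCLM A (WithLp.toLp 2
        w) + ψ) (EuclideanSpace.single t (1 : ℝ)) - (∫ w', U' (matrixCLM A (WithLp.toLp 2 w') + ψ) (EuclideanSpace.single t (1 : ℝ)) ∂((volume :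
        Measure (κ → ℝ)).tilted fun z => -(1 / 2 * (z ⬝ᵥ z) + U (matrixCLM A (WithLp.toLp 2 z) + ψ))))) ∂((volume : Measure (κ → ℝ)).tilted fun z =>
        -(1 / 2 * (z ⬝ᵥ z) + U (matrixCLM A (WithLp.toLp 2 z) + ψ)))) - (∫ w, (U' (matrixCLM A (WithLp.toLp 2 w) + ψ) (EuclideanSpace.single x (1 :
        ℝ)) - (∫ w', U' (matrixCLM A (WithLp.toLp 2 w') + ψ) (EuclideanSpace.single x (1 : ℝ)) ∂((volume : Measure (κ → ℝ)).tilted fun z => -(1 / 2 *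
        (z ⬝ᵥ z) + U (matrixCLM A (WithLp.toLp 2 z) + ψ))))) * (U' (matrixCLM A (WithLp.toLp 2 w) + ψ) (EuclideanSpace.single t (1 : ℝ)) - (∫ w', U'
        (matrixCLM A (WithLp.toLp 2 w') + ψ) (EuclideanSpace.single t (1 : ℝ)) ∂((volume : Measure (κ → ℝ)).tilted fun z => -(1 / 2 * (z ⬝ᵥ z) + U
        (matrixCLM A (WithLp.toLp 2 z) + ψ))))) ∂((volume : Measure (κ → ℝ)).tilted fun z => -(1 / 2 * (z ⬝ᵥ z) + U (matrixCLM A (WithLp.toLp 2 z) +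
        ψ)))) * (∫ w, (U' (matrixCLM A (WithLp.toLp 2 w) + ψ) (EuclideanSpace.single y (1 : ℝ)) - (∫ w', U' (matrixCLM A (WithLp.toLp 2 w') + ψ)
        (EuclideanSpace.single y (1 : ℝ)) ∂((volume : Measure (κ → ℝ)).tilted fun z => -(1 / 2 * (z ⬝ᵥ z) + U (matrixCLM A (WithLp.toLp 2 z) + ψ)))))
        * (U' (matrixCLM A (WithLp.toLp 2 w) + ψ) (EuclideanSpace.single z (1 : ℝ)) - (∫ w', U' (matrixCLM A (WithLp.toLp 2 w') + ψ)
        (EuclideanSpace.single z (1 : ℝ)) ∂((volume : Measure (κ → ℝ)).tilted fun z => -(1 / 2 * (z ⬝ᵥ z) + U (matrixCLM A (WithLp.toLp 2 z) + ψ)))))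
        ∂((volume : Measure (κ → ℝ)).tilted fun z => -(1 / 2 * (z ⬝ᵥ z) + U (matrixCLM A (WithLp.toLp 2 z) + ψ))))| ≤
      (4 * (αθ * dθ * (βθ * dθ') / (1 - lamA)) + 3 * (αθ * dθ * (βθ * dθ') / (1 - lamA)) ^ 2 + 4 * (5 * (κ₂ ^ 4 * γop ^ 2) / (1 - lam * γop) ^ 2) + 4
          * M₆ + 2 * (((5 * (κ₂ ^ 4 * γop ^ 2) / (1 - lam * γop) ^ 2) + 1) / 2) * ((((5 * (κ₂ ^ 4 * γop ^ 2) / (1 - lam * γop) ^ 2) + 1) / 2) + (5 *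
          (κ₂ ^ 4 * γop ^ 2) / (1 - lam * γop) ^ 2))) * (16 * S ^ 3) := by
  haveI : Nonempty ι := ⟨x⟩
  have hM6nn : 0 ≤ M₆ := le_trans (integral_nonneg fun w => by positivity) (hM6 x)
  have hαθ : 0 ≤ αθ := le_trans (Finset.sum_nonneg fun w _ => mul_nonneg (whitened_obs_nonneg hHk0 A x w) (hσ0 x w)) (haσ x)
  have hl1 : 0 < 1 - lamA := by linarith
  have hlg : 0 < 1 - lam * γop := by linarith
  have hC : 0 ≤ (4 * (αθ * dθ * (βθ * dθ') / (1 - lamA)) + 3 * (αθ * dθ * (βθ * dθ') / (1 - lamA)) ^ 2 + 4 * (5 * (κ₂ ^ 4 * γop ^ 2) / (1 - lam *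
      γop) ^ 2) + 4 * M₆ + 2 * (((5 * (κ₂ ^ 4 * γop ^ 2) / (1 - lam * γop) ^ 2) + 1) / 2) * ((((5 * (κ₂ ^ 4 * γop ^ 2) / (1 - lam * γop) ^ 2) + 1) /
      2) + (5 * (κ₂ ^ 4 * γop ^ 2) / (1 - lam * γop) ^ 2))) := by positivity
  refine le_trans (Finset.sum_le_sum fun y _ => Finset.sum_le_sum fun z _ => Finset.sum_le_sum fun t _ =>
    whitened_fourth_cumulant_tree hΓop Y hUd hU'd hU''c hκ₀ hκ₁ ha hτ hδ hθ0 hθ1 hκθ hκθw hstab hU'b hU''b hlam hUsec hρg hHk hHk0 ψ hαr hαc hhr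
        hlamA hlamA1 hγ hγ1 hD hDC hθnn hDr hdθ hDc hdθ' hσ0 hσθ hr1 hrσ haσ hβ haσ' hI6 hM6 x y z t) ?_
  have htree : ∑ y, ∑ z, ∑ t, ((r x y ^ 2)⁻¹ * (r x z ^ 2)⁻¹ * (r x t ^ 2)⁻¹ + (r x y ^ 2)⁻¹ * (r y z ^ 2)⁻¹ * (r y t ^ 2)⁻¹ + (r x z ^ 2)⁻¹ * (r y z
      ^ 2)⁻¹ * (r z t ^ 2)⁻¹ + (r x t ^ 2)⁻¹ * (r y t ^ 2)⁻¹ * (r z t ^ 2)⁻¹ + (r x y ^ 2)⁻¹ * (r y z ^ 2)⁻¹ * (r z t ^ 2)⁻¹ + (r x y ^ 2)⁻¹ * (r y t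
      ^ 2)⁻¹ * (r z t ^ 2)⁻¹ + (r x z ^ 2)⁻¹ * (r y z ^ 2)⁻¹ * (r y t ^ 2)⁻¹ + (r x z ^ 2)⁻¹ * (r y t ^ 2)⁻¹ * (r z t ^ 2)⁻¹ + (r x t ^ 2)⁻¹ * (r y z
      ^ 2)⁻¹ * (r y t ^ 2)⁻¹ + (r x t ^ 2)⁻¹ * (r y z ^ 2)⁻¹ * (r z t ^ 2)⁻¹ + (r x y ^ 2)⁻¹ * (r x z ^ 2)⁻¹ * (r z t ^ 2)⁻¹ + (r x y ^ 2)⁻¹ * (r x t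
      ^ 2)⁻¹ * (r z t ^ 2)⁻¹ + (r x y ^ 2)⁻¹ * (r x z ^ 2)⁻¹ * (r y t ^ 2)⁻¹ + (r x z ^ 2)⁻¹ * (r x t ^ 2)⁻¹ * (r y t ^ 2)⁻¹ + (r x y ^ 2)⁻¹ * (r x t
      ^ 2)⁻¹ * (r y z ^ 2)⁻¹ + (r x z ^ 2)⁻¹ * (r x t ^ 2)⁻¹ * (r y z ^ 2)⁻¹) ≤ 16 * S ^ 3 := by
    simpa only using tree_sum_row_le (q := fun u v => (r u v ^ 2)⁻¹) (fun u v => by positivity) hSr hSc x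
  calc ∑ y, ∑ z, ∑ t, (4 * (αθ * dθ * (βθ * dθ') / (1 - lamA)) + 3 * (αθ * dθ * (βθ * dθ') / (1 - lamA)) ^ 2 + 4 * (5 * (κ₂ ^ 4 * γop ^ 2) / (1 - lam
      * γop) ^ 2) + 4 * M₆ + 2 * (((5 * (κ₂ ^ 4 * γop ^ 2) / (1 - lam * γop) ^ 2) + 1) / 2) * ((((5 * (κ₂ ^ 4 * γop ^ 2) / (1 - lam * γop) ^ 2) + 1)
      / 2) + (5 * (κ₂ ^ 4 * γop ^ 2) / (1 - lam * γop) ^ 2))) *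
        ((r x y ^ 2)⁻¹ * (r x z ^ 2)⁻¹ * (r x t ^ 2)⁻¹ + (r x y ^ 2)⁻¹ * (r y z ^ 2)⁻¹ * (r y t ^ 2)⁻¹ + (r x z ^ 2)⁻¹ * (r y z ^ 2)⁻¹ * (r z t ^
            2)⁻¹ + (r x t ^ 2)⁻¹ * (r y t ^ 2)⁻¹ * (r z t ^ 2)⁻¹ + (r x y ^ 2)⁻¹ * (r y z ^ 2)⁻¹ * (r z t ^ 2)⁻¹ + (r x y ^ 2)⁻¹ * (r y t ^ 2)⁻¹ * (r
            z t ^ 2)⁻¹ + (r x z ^ 2)⁻¹ * (r y z ^ 2)⁻¹ * (r y t ^ 2)⁻¹ + (r x z ^ 2)⁻¹ * (r y t ^ 2)⁻¹ * (r z t ^ 2)⁻¹ + (r x t ^ 2)⁻¹ * (r y z ^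
            2)⁻¹ * (r y t ^ 2)⁻¹ + (r x t ^ 2)⁻¹ * (r y z ^ 2)⁻¹ * (r z t ^ 2)⁻¹ + (r x y ^ 2)⁻¹ * (r x z ^ 2)⁻¹ * (r z t ^ 2)⁻¹ + (r x y ^ 2)⁻¹ * (r
            x t ^ 2)⁻¹ * (r z t ^ 2)⁻¹ + (r x y ^ 2)⁻¹ * (r x z ^ 2)⁻¹ * (r y t ^ 2)⁻¹ + (r x z ^ 2)⁻¹ * (r x t ^ 2)⁻¹ * (r y t ^ 2)⁻¹ + (r x y ^
            2)⁻¹ * (r x t ^ 2)⁻¹ * (r y z ^ 2)⁻¹ + (r x z ^ 2)⁻¹ * (r x t ^ 2)⁻¹ * (r y z ^ 2)⁻¹)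
      = (4 * (αθ * dθ * (βθ * dθ') / (1 - lamA)) + 3 * (αθ * dθ * (βθ * dθ') / (1 - lamA)) ^ 2 + 4 * (5 * (κ₂ ^ 4 * γop ^ 2) / (1 - lam * γop) ^ 2) +
          4 * M₆ + 2 * (((5 * (κ₂ ^ 4 * γop ^ 2) / (1 - lam * γop) ^ 2) + 1) / 2) * ((((5 * (κ₂ ^ 4 * γop ^ 2) / (1 - lam * γop) ^ 2) + 1) / 2) + (5
          * (κ₂ ^ 4 * γop ^ 2) / (1 - lam * γop) ^ 2))) *
        ∑ y, ∑ z, ∑ t, ((r x y ^ 2)⁻¹ * (r x z ^ 2)⁻¹ * (r x t ^ 2)⁻¹ + (r x y ^ 2)⁻¹ * (r y z ^ 2)⁻¹ * (r y t ^ 2)⁻¹ + (r x z ^ 2)⁻¹ * (r y z ^ 2)⁻¹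
            * (r z t ^ 2)⁻¹ + (r x t ^ 2)⁻¹ * (r y t ^ 2)⁻¹ * (r z t ^ 2)⁻¹ + (r x y ^ 2)⁻¹ * (r y z ^ 2)⁻¹ * (r z t ^ 2)⁻¹ + (r x y ^ 2)⁻¹ * (r y t
            ^ 2)⁻¹ * (r z t ^ 2)⁻¹ + (r x z ^ 2)⁻¹ * (r y z ^ 2)⁻¹ * (r y t ^ 2)⁻¹ + (r x z ^ 2)⁻¹ * (r y t ^ 2)⁻¹ * (r z t ^ 2)⁻¹ + (r x t ^ 2)⁻¹ *
            (r y z ^ 2)⁻¹ * (r y t ^ 2)⁻¹ + (r x t ^ 2)⁻¹ * (r y z ^ 2)⁻¹ * (r z t ^ 2)⁻¹ + (r x y ^ 2)⁻¹ * (r x z ^ 2)⁻¹ * (r z t ^ 2)⁻¹ + (r x y ^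
            2)⁻¹ * (r x t ^ 2)⁻¹ * (r z t ^ 2)⁻¹ + (r x y ^ 2)⁻¹ * (r x z ^ 2)⁻¹ * (r y t ^ 2)⁻¹ + (r x z ^ 2)⁻¹ * (r x t ^ 2)⁻¹ * (r y t ^ 2)⁻¹ + (r
            x y ^ 2)⁻¹ * (r x t ^ 2)⁻¹ * (r y z ^ 2)⁻¹ + (r x z ^ 2)⁻¹ * (r x t ^ 2)⁻¹ * (r y z ^ 2)⁻¹) := by simp only [Finset.mul_sum]
    _ ≤ (4 * (αθ * dθ * (βθ * dθ') / (1 - lamA)) + 3 * (αθ * dθ * (βθ * dθ') / (1 - lamA)) ^ 2 + 4 * (5 * (κ₂ ^ 4 * γop ^ 2) / (1 - lam * γop) ^ 2) +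
        4 * M₆ + 2 * (((5 * (κ₂ ^ 4 * γop ^ 2) / (1 - lam * γop) ^ 2) + 1) / 2) * ((((5 * (κ₂ ^ 4 * γop ^ 2) / (1 - lam * γop) ^ 2) + 1) / 2) + (5 *
        (κ₂ ^ 4 * γop ^ 2) / (1 - lam * γop) ^ 2))) * (16 * S ^ 3) := mul_le_mul_of_nonneg_left htree hC

/-! ## Toy -/

/-- Toy: the constant in numbers with all letters `1` and `λγ = 0`: `4 + 3 + 20 + 4 + 2·(11∕2)·(11∕2 + 5) ≥ 0`. -/
example : (0 : ℝ) ≤ 4 * 1 + 3 * 1 ^ 2 + 4 * 5 + 4 * 1 + 2 * (11 / 2) * (11 / 2 + 5) := by norm_num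

end Summit.QuantumFields.BalabanUV.T4Continuum.NE7b.SupWhitenedFourthCumulantRowLetter

end
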